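import Literature.NumberTheory.EllipticCurves.EndomorphismEigenPrimaryTorsion
import HarnessLib

/-!
# The eigen-subgroup `E[𝔮^∞]` IS the printed kernel tower `⋃ₙ E[𝔮ⁿ]` (Rubin, LNM 1716, §5.1)

Topic `NumberTheory/EllipticCurves` (complex multiplication; the CM-prime decomposition of `E[p^∞]`).
Cell `bsd-print-cf2`, planner RULING (ae) (2026-08-28): the tree's ONE definition of the `𝔮`-primary
torsion of an elliptic curve with a `K`-rational endomorphism `π` is
`WeierstrassCurve.endEigenPrimaryTorsion V p π r` (file `EndomorphismEigenPrimaryTorsion`): the points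
`x ∈ E[p^∞]` on which `π` «acts as the `p`-adic integer `r`» (`p^k x = 0` and `N ≡ r (mod p^k)` imply
`π x = N x`). This file proves — theorems only, no definition, no instance, no named fact — that this
carrier is, on the nose, the object of the printed source:

* Rubin, LNM 1716, §5 (p. 179): "If `𝔞` is an ideal of `𝒪` we will write `E[𝔞] = ∩_{α ∈ 𝔞} E[α]`";
  §5.1 (p. 180, after Cor. 5.5): "If `𝔞` is a nonzero ideal of `𝒪` let `E[𝔞^∞] = ∪ₙ E[𝔞ⁿ]`."
  For a PRINCIPAL ideal `𝔞 = (π)` one has `E[(π)ⁿ] = E[πⁿ] = ker πⁿ` (every `α ∈ (πⁿ)` is a multiple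
  of `πⁿ`), so the printed `E[𝔮^∞]`, `𝔮 = (π)`, is `⋃ₙ ker πⁿ ⊆ E(K̄)`.

Setting of the theorems (the split-prime situation of the CM Iwasawa theory — Coates 1983 §2, Rubin
1991 §11, Agboola 2007 §3 — phrased for a bare endomorphism, no CM hypothesis needed): `V` an
elliptic curve over a field `K`, `π ∈ End_K(E)` (`V.endRing`) satisfying a monic integral quadratic
`π² = tπ − m` (`t m : ℤ`; for `𝒪 = ℤ[π]` this is the minimal polynomial, `t = Tr π`, `m = N π`), a prime
`p` NOT dividing `t`, and `r ∈ ℤ_p` a root of `X² − tX + m` with `‖r‖ < 1` (so `p ∣ m`, the other root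
`t − r` is a unit, and `X² − tX + m ≡ X(X − t)` splits with distinct roots mod `p`: `p` SPLITS in
`ℤ[π]`, `𝔮 = (p, π − r̃) ∋ π`). Then (§2 of this file):

* `mem_endEigenPrimaryTorsion_iff_exists_pow_apply_eq_zero` — for `x ∈ E[p^∞]`:
  `x ∈ V.endEigenPrimaryTorsion p π r ↔ ∃ n, πⁿ x = 0`; and at a fixed level `p^k x = 0`:
  `x ∈ … ↔ π^k x = 0` (`…_iff_pow_apply_eq_zero`) — "`E[𝔮^∞] ∩ E[p^k] = E[𝔮^k]`";
* `mem_map_subtype_endEigenPrimaryTorsion_iff` — when moreover `m = p` (norm `p`: `π` GENERATES a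
  prime of norm `p`, e.g. `π = (1 + √−7)/2`, `p = 2`), every point killed by a power of `π` is
  `p`-primary (`mem_geomPrimaryTorsion_of_pow_apply_eq_zero`), so the image of
  `V.endEigenPrimaryTorsion p π r` in `E(K̄)` is EXACTLY `{P ∈ E(K̄) | ∃ n, πⁿ P = 0} = ⋃ₙ E[πⁿ]` —
  Rubin's `E[𝔮^∞]`;
* `endEigenPrimaryTorsion_intCast_sub` — the CONJUGATE summand: the `(t − r)`-eigen-subgroup of `π` is
  the `r`-eigen-subgroup of `π̄ := t − π` (which satisfies the same quadratic), hence
  (`mem_endEigenPrimaryTorsion_intCast_sub_iff_exists_pow_apply_eq_zero`) it is `⋃ₙ ker π̄ⁿ = E[𝔮̄^∞]`,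
  `𝔮̄ = (π̄)`;
* §3: the `p = 2`, `π² = π − 2`, `r² = r − 2` corollaries in the exact hypotheses of the crux files
  `Summits/BirchSwinnertonDyer/BirchSwinnertonDyer/Theorems/PrintCf2SplitBadTwoCM*.lean` (`K ∋ √−7`,
  `j = −3375`): their summands `C₁` (π acts as `r`) and `C₂` (π acts as `1 − r`) are `⋃ₙ E[𝔭ⁿ]` and
  `⋃ₙ E[𝔭̄ⁿ]`, `𝔭 = (π)`, `𝔭̄ = (1 − π)`, `𝔭𝔭̄ = (2)`.

§1 is the underlying elementary algebra for an additive endomorphism `φ` of any abelian group `A`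
(no curve): `apply_eq_zsmul_of_pow_apply_eq_zero` (kernel tower ⊆ eigen) and
`pow_apply_eq_zero_of_apply_eq_zsmul` (eigen ⊆ kernel tower). Proof of the former (the only
non-trivial step): for `x` with `p^k x = 0`, `πⁿ x = 0`, `N ≡ r (p^k)`, put `s = t − N` and
`a = π x − N x`; from `N² − tN + m ≡ 0 (p^k)` one gets `π a = s a`, hence `πⁿ a = sⁿ a`; but
`πⁿ a = π(πⁿ x) − N πⁿ x = 0` and `p ∤ s` (`p ∣ N`, `p ∤ t`), so `a = 0`.

## References

* [Rubin1999] K. Rubin, *Elliptic curves with complex multiplication and the conjecture of Birch and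
  Swinnerton-Dyer*, LNM 1716 (1999), §5 p. 179 (`E[𝔞] = ∩ E[α]`), §5.1 p. 180 (`E[𝔞^∞] = ∪ E[𝔞ⁿ]`),
  Prop. 5.4, Cor. 5.5–5.6 (held: `book:coatesnd-arithmetic-theory-elliptic-curves`, PDF p0226 L16,
  p0227 L5–L31).
* J. H. Silverman, *Advanced Topics in the Arithmetic of Elliptic Curves*, GTM 151, II §1 (`E[𝔞]`).
* A. Agboola, Compositio Math. 143 (2007), Notation p. 1376 ("`W := E_{π^∞}`, `W* := E_{π*^∞}`").

## Design

`noncomputable section`, `open scoped Classical`, universe `u` as in the definition file. §1 in the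
namespace `Literature.NumberTheory.EllipticCurves.EndEigenKernelTower` (generic, `AddMonoid.End A`);
§§2–3 are dot-notation extensions in `namespace WeierstrassCurve` keyed to
`WeierstrassCurve.mem_endEigenPrimaryTorsion_iff` (`Iff.rfl`); uncited plumbing lemmas are `private`. The quadratic relation is taken
POINTWISE (`∀ y, π (π y) = t • π y − m • y`), which any ring identity `π * π = t * π − m` in
`AddMonoid.End E(K̄)` yields by evaluation (§3 does this for `π * π = π − 2`).
-/

noncomputable section

open scoped Classical

universe u

namespace Literature.NumberTheory.EllipticCurves

/-! ### §1. Elementary algebra: eigen-condition versus kernel tower for one additive endomorphism -/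

namespace EndEigenKernelTower

variable {A : Type*} [AddCommGroup A] {p : ℕ} [hp : Fact p.Prime]

/-- If `N ≡ r (mod p^k)` with `k ≠ 0` and `‖r‖ < 1`, then `p ∣ N`. [folklore] -/
private theorem int_dvd_of_sub_mem_span_pow {r : ℤ_[p]} (hr1 : ‖r‖ < 1) {k : ℕ} (hk : k ≠ 0) {N : ℤ}
    (hN : ((N : ℤ_[p]) - r) ∈ (Ideal.span {(p : ℤ_[p]) ^ k} : Ideal ℤ_[p])) : (p : ℤ) ∣ N := by
  rw [← PadicInt.norm_int_lt_one_iff_dvd, PadicInt.norm_lt_one_iff_dvd]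
  have h1 : (p : ℤ_[p]) ∣ (N : ℤ_[p]) - r :=
    (dvd_pow_self (p : ℤ_[p]) hk).trans (Ideal.mem_span_singleton.mp hN)
  have h2 : (p : ℤ_[p]) ∣ r := (PadicInt.norm_lt_one_iff_dvd r).mp hr1
  simpa using dvd_add h1 h2

/-- If `N ≡ r (mod p^k)` and `r² = t r − m` in `ℤ_p`, then `p^k ∣ N² − tN + m`. [folklore] -/
private theorem pow_dvd_of_sub_mem_span_pow {r : ℤ_[p]} {t m : ℤ} (hr : r * r = t * r - m) {k : ℕ} {N : ℤ}
    (hN : ((N : ℤ_[p]) - r) ∈ (Ideal.span {(p : ℤ_[p]) ^ k} : Ideal ℤ_[p])) :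
    ((p : ℤ) ^ k) ∣ N * N - t * N + m := by
  have hmem : ((N * N - t * N + m : ℤ) : ℤ_[p]) ∈ (Ideal.span {(p : ℤ_[p]) ^ k} : Ideal ℤ_[p]) := by
    have h := Ideal.mul_mem_right ((N : ℤ_[p]) + r - t) _ hN
    have e : ((N * N - t * N + m : ℤ) : ℤ_[p]) = ((N : ℤ_[p]) - r) * ((N : ℤ_[p]) + r - t) := by
      push_cast
      linear_combination hr
    rw [e]
    exact h
  have h := (PadicInt.norm_le_pow_iff_mem_span_pow _ _).mpr hmem
  exact_mod_cast PadicInt.norm_int_le_pow_iff_dvd.mp h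

/-- A `p^k`-torsion element killed by an integer prime to `p` is zero. [folklore] -/
private theorem eq_zero_of_zsmul_eq_zero_of_not_dvd {c : ℤ} (hc : ¬ (p : ℤ) ∣ c) {k : ℕ} {a : A}
    (hk : p ^ k • a = 0) (hca : c • a = 0) : a = 0 := by
  have hpirr : Irreducible (p : ℤ) := (Nat.prime_iff_prime_int.mp hp.out).irreducible
  have hcop : IsCoprime ((p : ℤ) ^ k) c := (hpirr.coprime_iff_not_dvd.mpr hc).pow_left
  obtain ⟨x, y, hxy⟩ := hcop
  have hk' : ((p : ℤ) ^ k) • a = 0 := by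
    rw [show ((p : ℤ) ^ k) = ((p ^ k : ℕ) : ℤ) by push_cast; rfl, natCast_zsmul, hk]
  calc a = (x * (p : ℤ) ^ k + y * c) • a := by rw [hxy, one_zsmul]
    _ = 0 := by rw [add_zsmul, mul_zsmul, mul_zsmul, hk', hca, zsmul_zero, zsmul_zero, add_zero]

/-- If `φ a = N • a` then `φⁿ a = Nⁿ • a`. [folklore] -/
private theorem pow_apply_eq_pow_zsmul (φ : AddMonoid.End A) {a : A} {N : ℤ} (h : φ a = N • a) (n : ℕ) :
    (φ ^ n) a = (N ^ n) • a := by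
  induction n with
  | zero => simp
  | succ n ih =>
    rw [pow_succ', AddMonoid.End.coe_mul, Function.comp_apply, ih, map_zsmul, h, smul_smul,
      pow_succ]

omit hp in
/-- An additive endomorphism preserves `p^k`-torsion. [folklore] -/
private theorem nsmul_apply_eq_zero (φ : AddMonoid.End A) {k : ℕ} {a : A} (hk : p ^ k • a = 0) :
    p ^ k • φ a = 0 := by
  rw [← map_nsmul, hk, map_zero]

omit hp in
/-- **Eigen ⟹ kernel tower.** If `p^k x = 0` and `φ x = N x` with `p ∣ N`, then `φ^k x = 0`.
[cite: Rubin1999, §5.1 (p. 180: E[𝔞^∞] = ∪ E[𝔞ⁿ])] -/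
theorem pow_apply_eq_zero_of_apply_eq_zsmul (φ : AddMonoid.End A) {x : A} {k : ℕ}
    (hk : p ^ k • x = 0) {N : ℤ} (hpN : (p : ℤ) ∣ N) (hφ : φ x = N • x) : (φ ^ k) x = 0 := by
  rw [pow_apply_eq_pow_zsmul φ hφ k]
  obtain ⟨c, hc⟩ := pow_dvd_pow_of_dvd hpN k
  rw [hc, mul_comm, mul_zsmul, show ((p : ℤ) ^ k) = ((p ^ k : ℕ) : ℤ) by push_cast; rfl,
    natCast_zsmul, hk, zsmul_zero]

/-- **Kernel tower ⟹ eigen** (the non-trivial inclusion). Let `φ` satisfy `φ² = tφ − m` pointwise,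
`r ∈ ℤ_p` with `r² = tr − m`, `‖r‖ < 1`, and `p ∤ t`. If `φⁿ x = 0`, `p^k x = 0` and
`N ≡ r (mod p^k)`, then `φ x = N x`. (With `s = t − N`, `a = φ x − N x`: `φ a = s a` because
`p^k ∣ N² − tN + m`; `φⁿ a = 0`; `sⁿ a = 0` with `p ∤ s`; so `a = 0`.)
[cite: Rubin1999, §5 (p. 179: E[𝔞] = ∩_{α ∈ 𝔞} E[α]) and §5.1 (p. 180)] -/
theorem apply_eq_zsmul_of_pow_apply_eq_zero (φ : AddMonoid.End A) {t m : ℤ}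
    (hφ : ∀ y, φ (φ y) = t • φ y - m • y) {r : ℤ_[p]} (hr : r * r = t * r - m) (hr1 : ‖r‖ < 1)
    (ht : ¬ (p : ℤ) ∣ t) {x : A} {n : ℕ} (hn : (φ ^ n) x = 0) {k : ℕ} (hk : p ^ k • x = 0) {N : ℤ}
    (hN : ((N : ℤ_[p]) - r) ∈ (Ideal.span {(p : ℤ_[p]) ^ k} : Ideal ℤ_[p])) : φ x = N • x := by
  by_cases hk0 : k = 0
  · subst hk0
    rw [pow_zero, one_smul] at hk
    rw [hk, map_zero, zsmul_zero]
  have hpN : (p : ℤ) ∣ N := int_dvd_of_sub_mem_span_pow hr1 hk0 hN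
  have hcong : ((p : ℤ) ^ k) ∣ N * N - t * N + m := pow_dvd_of_sub_mem_span_pow hr hN
  -- `s = t - N` is prime to `p`
  have hs : ¬ (p : ℤ) ∣ (t - N) := fun h ↦ ht (by simpa using dvd_add h hpN)
  -- the element `a = φ x - N • x`
  set a : A := φ x - N • x with ha_def
  have hka : p ^ k • a = 0 := by
    rw [ha_def, smul_sub, nsmul_apply_eq_zero φ hk, smul_comm, hk, smul_zero, sub_zero]
  -- `(s N - m) • x = 0` since `p^k ∣ N² - tN + m = -(sN - m)`
  have hsm : ((t - N) * N - m) • x = 0 := by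
    obtain ⟨c, hc⟩ := hcong
    have e : (t - N) * N - m = -((p : ℤ) ^ k * c) := by rw [← hc]; ring
    rw [e, neg_zsmul, mul_comm, mul_zsmul, show ((p : ℤ) ^ k) = ((p ^ k : ℕ) : ℤ) by push_cast; rfl,
      natCast_zsmul, hk, zsmul_zero, neg_zero]
  -- `φ a = s • a`
  have hφa : φ a = (t - N) • a := by
    rw [ha_def, map_sub, map_zsmul, hφ x, smul_sub, smul_smul]
    have e : t • φ x - m • x - N • φ x - ((t - N) • φ x - ((t - N) * N) • x) =
        ((t - N) * N - m) • x := by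
      simp only [sub_zsmul, mul_comm]
      abel
    rw [← sub_eq_zero, e, hsm]
  -- `φⁿ a = 0`
  have hna : (φ ^ n) a = 0 := by
    rw [ha_def, map_sub, map_zsmul, hn, zsmul_zero, sub_zero, ← Function.comp_apply (f := ⇑(φ ^ n)),
      ← AddMonoid.End.coe_mul, ← pow_succ, pow_succ', AddMonoid.End.coe_mul, Function.comp_apply, hn,
      map_zero]
  -- `sⁿ a = 0`, hence `a = 0`
  have hsn : ((t - N) ^ n) • a = 0 := by rw [← pow_apply_eq_pow_zsmul φ hφa n, hna]
  have hsn' : ¬ (p : ℤ) ∣ (t - N) ^ n := fun h ↦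
    hs ((Nat.prime_iff_prime_int.mp hp.out).dvd_of_dvd_pow h)
  have ha0 : a = 0 := eq_zero_of_zsmul_eq_zero_of_not_dvd hsn' hka hsn
  rwa [ha_def, sub_eq_zero] at ha0

omit hp in
/-- **Norm `p`: the kernel tower is `p`-primary.** If `φ² = tφ − p` pointwise then `φⁿ y = 0`
implies `pⁿ y = 0` (`φ̄ φ = p` with `φ̄ = t − φ`). [cite: Rubin1999, §5.1 (p. 180)] -/
theorem nsmul_pow_eq_zero_of_pow_apply_eq_zero (φ : AddMonoid.End A) {t : ℤ}
    (hφ : ∀ y, φ (φ y) = t • φ y - (p : ℤ) • y) {n : ℕ} {y : A} (hn : (φ ^ n) y = 0) :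
    p ^ n • y = 0 := by
  induction n generalizing y with
  | zero => simpa using hn
  | succ n ih =>
    rw [pow_succ, AddMonoid.End.coe_mul, Function.comp_apply] at hn
    have h1 : p ^ n • φ y = 0 := ih hn
    have h2 : φ (p ^ n • y) = 0 := by rw [map_nsmul, h1]
    have h3 : (p : ℤ) • (p ^ n • y) = 0 := by
      have e := hφ (p ^ n • y)
      rw [h2, map_zero, smul_zero, zero_sub, zero_eq_neg] at e
      exact e
    rw [natCast_zsmul] at h3
    rw [pow_succ, mul_nsmul]
    exact h3

end EndEigenKernelTower

end Literature.NumberTheory.EllipticCurves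

/-! ### §2. `endEigenPrimaryTorsion` versus the printed `E[𝔮^∞] = ⋃ₙ E[𝔮ⁿ]` -/

namespace WeierstrassCurve

open Literature.NumberTheory.EllipticCurves Literature.NumberTheory.EllipticCurves.EndEigenKernelTower
  Field

variable {K : Type u} [Field K] {V : WeierstrassCurve K} {p : ℕ} [hp : Fact p.Prime]

/-- An integer `N ≡ r (mod p^k)` exists (`N = r.appr k`). [folklore] -/
private theorem exists_int_sub_mem_span_pow (r : ℤ_[p]) (k : ℕ) :
    ∃ N : ℤ, ((N : ℤ_[p]) - r) ∈ (Ideal.span {(p : ℤ_[p]) ^ k} : Ideal ℤ_[p]) := by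
  refine ⟨(PadicInt.appr r k : ℤ), ?_⟩
  have h := PadicInt.appr_spec k r
  rw [← Ideal.neg_mem_iff, neg_sub] at h
  push_cast
  exact h

omit hp in
/-- Transport of `p^k • x = 0` between `E[p^∞]` and `E(K̄)`. [folklore] -/
private theorem nsmul_eq_zero_iff_coe (x : V.geomPrimaryTorsion p) (k : ℕ) :
    p ^ k • x = 0 ↔ p ^ k • (x : V.geomPoints) = 0 := by
  rw [← Subtype.coe_inj, AddSubmonoidClass.coe_nsmul, ZeroMemClass.coe_zero]

/-- **`E[𝔮^∞] ∩ E[p^k] = E[𝔮^k]` at a fixed level**: for `x ∈ E[p^∞]` with `p^k x = 0`,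
`x ∈ V.endEigenPrimaryTorsion p π r ↔ π^k x = 0` — under `π² = tπ − m` (pointwise), `r² = tr − m`,
`‖r‖ < 1`, `p ∤ t`. [cite: Rubin1999, §5 (p. 179) and §5.1 (p. 180)] -/
theorem mem_endEigenPrimaryTorsion_iff_pow_apply_eq_zero (π : V.endRing) {t m : ℤ}
    (hπ : ∀ y : V.geomPoints, (π : AddMonoid.End V.geomPoints) ((π : AddMonoid.End V.geomPoints) y) =
      t • (π : AddMonoid.End V.geomPoints) y - m • y)
    {r : ℤ_[p]} (hr : r * r = t * r - m) (hr1 : ‖r‖ < 1) (ht : ¬ (p : ℤ) ∣ t)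
    {x : V.geomPrimaryTorsion p} {k : ℕ} (hk : p ^ k • x = 0) :
    x ∈ V.endEigenPrimaryTorsion p π r ↔
      ((π : AddMonoid.End V.geomPoints) ^ k) (x : V.geomPoints) = 0 := by
  have hk' : p ^ k • (x : V.geomPoints) = 0 := (nsmul_eq_zero_iff_coe x k).mp hk
  constructor
  · intro hx
    by_cases hk0 : k = 0
    · subst hk0
      rw [pow_zero, one_smul] at hk'
      rw [hk', map_zero]
    obtain ⟨N, hN⟩ := exists_int_sub_mem_span_pow r k
    exact pow_apply_eq_zero_of_apply_eq_zsmul _ hk' (int_dvd_of_sub_mem_span_pow hr1 hk0 hN)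
      ((V.mem_endEigenPrimaryTorsion_iff π r x).mp hx k N hk hN)
  · intro hx
    rw [mem_endEigenPrimaryTorsion_iff]
    intro k' N hk'' hN
    exact apply_eq_zsmul_of_pow_apply_eq_zero _ hπ hr hr1 ht hx
      ((nsmul_eq_zero_iff_coe x k').mp hk'') hN

/-- **`endEigenPrimaryTorsion = ⋃ₙ E[𝔮ⁿ]` (Rubin's `E[𝔮^∞]`, `𝔮 = (π)`)**: for `x ∈ E[p^∞]`,
`x ∈ V.endEigenPrimaryTorsion p π r ↔ ∃ n, πⁿ x = 0` — under `π² = tπ − m` (pointwise),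
`r² = tr − m`, `‖r‖ < 1`, `p ∤ t` (the prime `p` splits in `ℤ[π]` and `r` is the root at `𝔮 ∋ π`).
[cite: Rubin1999, §5 (p. 179: E[𝔞] = ∩_{α∈𝔞} E[α]) and §5.1 (p. 180: E[𝔞^∞] = ∪ₙ E[𝔞ⁿ])] -/
theorem mem_endEigenPrimaryTorsion_iff_exists_pow_apply_eq_zero (π : V.endRing) {t m : ℤ}
    (hπ : ∀ y : V.geomPoints, (π : AddMonoid.End V.geomPoints) ((π : AddMonoid.End V.geomPoints) y) =
      t • (π : AddMonoid.End V.geomPoints) y - m • y)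
    {r : ℤ_[p]} (hr : r * r = t * r - m) (hr1 : ‖r‖ < 1) (ht : ¬ (p : ℤ) ∣ t)
    (x : V.geomPrimaryTorsion p) :
    x ∈ V.endEigenPrimaryTorsion p π r ↔
      ∃ n : ℕ, ((π : AddMonoid.End V.geomPoints) ^ n) (x : V.geomPoints) = 0 := by
  obtain ⟨k, hk⟩ := (AddCommGroup.mem_primaryComponent).mp x.2
  have hkx : p ^ k • x = 0 := (nsmul_eq_zero_iff_coe x k).mpr hk
  constructor
  · intro hx
    exact ⟨k, (mem_endEigenPrimaryTorsion_iff_pow_apply_eq_zero π hπ hr hr1 ht hkx).mp hx⟩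
  · rintro ⟨n, hn⟩
    rw [mem_endEigenPrimaryTorsion_iff]
    intro k' N hk' hN
    exact apply_eq_zsmul_of_pow_apply_eq_zero _ hπ hr hr1 ht hn
      ((nsmul_eq_zero_iff_coe x k').mp hk') hN

omit hp in
/-- **Norm `p`: every point killed by a power of `π` is `p`-primary** (`π̄ π = p`), so the printed
`E[𝔮^∞] = ⋃ₙ ker πⁿ ⊆ E(K̄)` lies inside `E[p^∞]`. Hypothesis: `π² = tπ − p` pointwise.
[cite: Rubin1999, §5.1 (p. 180)] -/
theorem mem_geomPrimaryTorsion_of_pow_apply_eq_zero (π : V.endRing) {t : ℤ}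
    (hπ : ∀ y : V.geomPoints, (π : AddMonoid.End V.geomPoints) ((π : AddMonoid.End V.geomPoints) y) =
      t • (π : AddMonoid.End V.geomPoints) y - (p : ℤ) • y)
    {y : V.geomPoints} {n : ℕ} (hn : ((π : AddMonoid.End V.geomPoints) ^ n) y = 0) :
    y ∈ V.geomPrimaryTorsion p :=
  (AddCommGroup.mem_primaryComponent).mpr ⟨n, nsmul_pow_eq_zero_of_pow_apply_eq_zero _ hπ hn⟩

/-- **Print-faithfulness on the nose (norm `p`)**: the image of `V.endEigenPrimaryTorsion p π r` in
`E(K̄)` is `{P ∈ E(K̄) | ∃ n, πⁿ P = 0} = ⋃ₙ E[πⁿ] = E[𝔮^∞]` for `𝔮 = (π)` of norm `p` — under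
`π² = tπ − p` (pointwise), `r² = tr − p`, `‖r‖ < 1`, `p ∤ t`.
[cite: Rubin1999, §5 (p. 179) and §5.1 (p. 180: E[𝔞^∞] = ∪ₙ E[𝔞ⁿ])] -/
theorem mem_map_subtype_endEigenPrimaryTorsion_iff (π : V.endRing) {t : ℤ}
    (hπ : ∀ y : V.geomPoints, (π : AddMonoid.End V.geomPoints) ((π : AddMonoid.End V.geomPoints) y) =
      t • (π : AddMonoid.End V.geomPoints) y - (p : ℤ) • y)
    {r : ℤ_[p]} (hr : r * r = t * r - p) (hr1 : ‖r‖ < 1) (ht : ¬ (p : ℤ) ∣ t) (y : V.geomPoints) :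
    y ∈ (V.endEigenPrimaryTorsion p π r).map (V.geomPrimaryTorsion p).subtype ↔
      ∃ n : ℕ, ((π : AddMonoid.End V.geomPoints) ^ n) y = 0 := by
  constructor
  · rintro ⟨x, hx, rfl⟩
    exact (mem_endEigenPrimaryTorsion_iff_exists_pow_apply_eq_zero π hπ hr hr1 ht x).mp hx
  · rintro ⟨n, hn⟩
    refine ⟨⟨y, mem_geomPrimaryTorsion_of_pow_apply_eq_zero π hπ hn⟩, ?_, rfl⟩
    exact (mem_endEigenPrimaryTorsion_iff_exists_pow_apply_eq_zero π hπ hr hr1 ht _).mpr ⟨n, hn⟩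

/-- Evaluation of the conjugate endomorphism `π̄ = t − π ∈ End_K(E)`: `π̄ y = t • y − π y`. [folklore] -/
private theorem coe_intCast_sub_apply (π : V.endRing) (t : ℤ) (y : V.geomPoints) :
    (((t : V.endRing) - π : V.endRing) : AddMonoid.End V.geomPoints) y =
      t • y - (π : AddMonoid.End V.geomPoints) y := by
  change ((t : V.endRing) : AddMonoid.End V.geomPoints) y - (π : AddMonoid.End V.geomPoints) y = _
  rw [SubringClass.coe_intCast, AddMonoid.End.intCast_apply]

/-- The conjugate `π̄ = t − π` satisfies the same quadratic `π̄² = tπ̄ − m` (pointwise). [folklore] -/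
private theorem conj_quadratic (π : V.endRing) {t m : ℤ}
    (hπ : ∀ y : V.geomPoints, (π : AddMonoid.End V.geomPoints) ((π : AddMonoid.End V.geomPoints) y) =
      t • (π : AddMonoid.End V.geomPoints) y - m • y) (y : V.geomPoints) :
    (((t : V.endRing) - π : V.endRing) : AddMonoid.End V.geomPoints)
        ((((t : V.endRing) - π : V.endRing) : AddMonoid.End V.geomPoints) y) =
      t • (((t : V.endRing) - π : V.endRing) : AddMonoid.End V.geomPoints) y - m • y := by
  simp only [coe_intCast_sub_apply, smul_sub, map_sub, map_zsmul, hπ y, smul_smul]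
  abel

/-- **The conjugate summand**: the `(t − r)`-eigen-subgroup of `π` is the `r`-eigen-subgroup of
`π̄ = t − π` (`N ≡ t − r ⇔ t − N ≡ r`, `π x = N x ⇔ π̄ x = (t − N) x`). No hypothesis on `π`, `r`.
[cite: Rubin1999, §5.1 (p. 180)] -/
theorem endEigenPrimaryTorsion_intCast_sub (π : V.endRing) (r : ℤ_[p]) (t : ℤ) :
    V.endEigenPrimaryTorsion p π ((t : ℤ_[p]) - r) = V.endEigenPrimaryTorsion p ((t : V.endRing) - π) r := by
  ext x
  simp only [mem_endEigenPrimaryTorsion_iff, coe_intCast_sub_apply]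
  constructor
  · intro h k N hk hN
    have hN' : (((t - N : ℤ) : ℤ_[p]) - ((t : ℤ_[p]) - r)) ∈ (Ideal.span {(p : ℤ_[p]) ^ k} : Ideal ℤ_[p]) := by
      rw [← Ideal.neg_mem_iff]
      push_cast
      convert hN using 1
      ring
    rw [h k (t - N) hk hN', sub_zsmul]
    abel
  · intro h k N hk hN
    have hN' : (((t - N : ℤ) : ℤ_[p]) - r) ∈ (Ideal.span {(p : ℤ_[p]) ^ k} : Ideal ℤ_[p]) := by
      rw [← Ideal.neg_mem_iff]
      push_cast
      convert hN using 1
      ring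
    -- `t • x - π x = (t - N) • x` ⟹ `π x = N • x`
    have e := h k (t - N) hk hN'
    calc (π : AddMonoid.End V.geomPoints) (x : V.geomPoints)
        = t • (x : V.geomPoints) - (t • (x : V.geomPoints) - (π : AddMonoid.End V.geomPoints) x) := by
          abel
      _ = t • (x : V.geomPoints) - (t - N) • (x : V.geomPoints) := by rw [e]
      _ = N • (x : V.geomPoints) := by rw [sub_zsmul]; abel

/-- **The conjugate summand is `⋃ₙ E[𝔮̄ⁿ]`, `𝔮̄ = (π̄)`, `π̄ = t − π`**: for `x ∈ E[p^∞]`,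
`x ∈ V.endEigenPrimaryTorsion p π (t − r) ↔ ∃ n, π̄ⁿ x = 0` — under `π² = tπ − m` (pointwise),
`r² = tr − m`, `‖r‖ < 1`, `p ∤ t`. [cite: Rubin1999, §5.1 (p. 180: E[𝔞^∞] = ∪ₙ E[𝔞ⁿ])] -/
theorem mem_endEigenPrimaryTorsion_intCast_sub_iff_exists_pow_apply_eq_zero (π : V.endRing) {t m : ℤ}
    (hπ : ∀ y : V.geomPoints, (π : AddMonoid.End V.geomPoints) ((π : AddMonoid.End V.geomPoints) y) =
      t • (π : AddMonoid.End V.geomPoints) y - m • y)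
    {r : ℤ_[p]} (hr : r * r = t * r - m) (hr1 : ‖r‖ < 1) (ht : ¬ (p : ℤ) ∣ t)
    (x : V.geomPrimaryTorsion p) :
    x ∈ V.endEigenPrimaryTorsion p π ((t : ℤ_[p]) - r) ↔
      ∃ n : ℕ, ((((t : V.endRing) - π : V.endRing) : AddMonoid.End V.geomPoints) ^ n)
        (x : V.geomPoints) = 0 := by
  rw [endEigenPrimaryTorsion_intCast_sub]
  exact mem_endEigenPrimaryTorsion_iff_exists_pow_apply_eq_zero _ (conj_quadratic π hπ) hr hr1 ht x

/-! ### §3. The case `p = 2`, `π² = π − 2` (`K ∋ √−7`, `j = −3375`): the crux files' summands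
`C₁ = ⋃ₙ E[𝔭ⁿ]`, `C₂ = ⋃ₙ E[𝔭̄ⁿ]` -/

section Two

variable {V : WeierstrassCurve K}

/-- Pointwise form of `π * π = π − 2`: `π (π y) = 1 • π y − 2 • y`. [folklore] -/
private theorem quadratic_two_pointwise (π : V.endRing)
    (hπ : (π : AddMonoid.End V.geomPoints) * π = π - 2) (y : V.geomPoints) :
    (π : AddMonoid.End V.geomPoints) ((π : AddMonoid.End V.geomPoints) y) =
      (1 : ℤ) • (π : AddMonoid.End V.geomPoints) y - (2 : ℤ) • y := by
  have e := congrArg (fun φ : AddMonoid.End V.geomPoints ↦ φ y) hπ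
  simp only [AddMonoid.End.coe_mul, Function.comp_apply] at e
  rw [e, one_zsmul]
  change _ - ((2 : ℕ) : AddMonoid.End V.geomPoints) y = _
  rw [AddMonoid.End.natCast_apply]
  norm_cast

/-- `r * r = r − 2` in the form `r * r = 1 * r − 2`. [folklore] -/
private theorem root_two_form {r : ℤ_[2]} (hr : r * r = r - 2) : r * r = (1 : ℤ) * r - (2 : ℤ) := by
  rw [hr]; push_cast; ring

/-- **`C₁ = ⋃ₙ E[𝔭ⁿ]`** (`p = 2`, `π² = π − 2`, `r² = r − 2`, `‖r‖ < 1`): for `x ∈ E[2^∞]`,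
`x ∈ V.endEigenPrimaryTorsion 2 π r ↔ ∃ n, πⁿ x = 0`. [cite: Rubin1999, §5.1 (p. 180: E[𝔞^∞] = ∪ₙ E[𝔞ⁿ])] -/
theorem mem_endEigenPrimaryTorsion_two_iff_exists_pow_apply_eq_zero (π : V.endRing)
    (hπ : (π : AddMonoid.End V.geomPoints) * π = π - 2) {r : ℤ_[2]} (hr : r * r = r - 2)
    (hr1 : ‖r‖ < 1) (x : V.geomPrimaryTorsion 2) :
    x ∈ V.endEigenPrimaryTorsion 2 π r ↔
      ∃ n : ℕ, ((π : AddMonoid.End V.geomPoints) ^ n) (x : V.geomPoints) = 0 :=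
  mem_endEigenPrimaryTorsion_iff_exists_pow_apply_eq_zero π (quadratic_two_pointwise π hπ)
    (root_two_form hr) hr1 (by decide) x

/-- **`C₁ ∩ E[2^k] = E[𝔭^k] = ker π^k`** (`p = 2`): for `x ∈ E[2^∞]` with `2^k x = 0`,
`x ∈ V.endEigenPrimaryTorsion 2 π r ↔ π^k x = 0`. [cite: Rubin1999, §5 (p. 179) and §5.1 (p. 180)] -/
theorem mem_endEigenPrimaryTorsion_two_iff_pow_apply_eq_zero (π : V.endRing)
    (hπ : (π : AddMonoid.End V.geomPoints) * π = π - 2) {r : ℤ_[2]} (hr : r * r = r - 2)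
    (hr1 : ‖r‖ < 1) {x : V.geomPrimaryTorsion 2} {k : ℕ} (hk : 2 ^ k • x = 0) :
    x ∈ V.endEigenPrimaryTorsion 2 π r ↔
      ((π : AddMonoid.End V.geomPoints) ^ k) (x : V.geomPoints) = 0 :=
  mem_endEigenPrimaryTorsion_iff_pow_apply_eq_zero π (quadratic_two_pointwise π hπ)
    (root_two_form hr) hr1 (by decide) hk

/-- **`C₂ = ⋃ₙ E[𝔭̄ⁿ]`, `𝔭̄ = (1 − π)`** (`p = 2`): for `x ∈ E[2^∞]`,
`x ∈ V.endEigenPrimaryTorsion 2 π (1 − r) ↔ ∃ n, (1 − π)ⁿ x = 0`.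
[cite: Rubin1999, §5.1 (p. 180: E[𝔞^∞] = ∪ₙ E[𝔞ⁿ])] -/
theorem mem_endEigenPrimaryTorsion_two_one_sub_iff_exists_pow_apply_eq_zero (π : V.endRing)
    (hπ : (π : AddMonoid.End V.geomPoints) * π = π - 2) {r : ℤ_[2]} (hr : r * r = r - 2)
    (hr1 : ‖r‖ < 1) (x : V.geomPrimaryTorsion 2) :
    x ∈ V.endEigenPrimaryTorsion 2 π (1 - r) ↔
      ∃ n : ℕ, ((((1 : V.endRing) - π : V.endRing) : AddMonoid.End V.geomPoints) ^ n)
        (x : V.geomPoints) = 0 := by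
  have h := mem_endEigenPrimaryTorsion_intCast_sub_iff_exists_pow_apply_eq_zero π
    (quadratic_two_pointwise π hπ) (root_two_form hr) hr1 (by decide) x (t := 1)
  simp only [Int.cast_one] at h
  exact h

/-- **The two summands are conjugate eigen-subgroups** (`p = 2`): `C₂`, the `(1 − r)`-eigen-subgroup
of `π`, is the `r`-eigen-subgroup of `π̄ = 1 − π`. [cite: Rubin1999, §5.1 (p. 180)] -/
theorem endEigenPrimaryTorsion_two_one_sub (π : V.endRing) (r : ℤ_[2]) :
    V.endEigenPrimaryTorsion 2 π (1 - r) = V.endEigenPrimaryTorsion 2 ((1 : V.endRing) - π) r := by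
  simpa only [Int.cast_one] using endEigenPrimaryTorsion_intCast_sub (p := 2) π r 1

/-- **Norm `2`: `⋃ₙ ker πⁿ ⊆ E[2^∞]`** (`π̄ π = 2`): a point killed by a power of `π` is
`2`-primary. [cite: Rubin1999, §5.1 (p. 180)] -/
theorem mem_geomPrimaryTorsion_two_of_pow_apply_eq_zero (π : V.endRing)
    (hπ : (π : AddMonoid.End V.geomPoints) * π = π - 2) {y : V.geomPoints} {n : ℕ}
    (hn : ((π : AddMonoid.End V.geomPoints) ^ n) y = 0) : y ∈ V.geomPrimaryTorsion 2 :=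
  mem_geomPrimaryTorsion_of_pow_apply_eq_zero π (t := 1)
    (fun z ↦ by simpa using quadratic_two_pointwise π hπ z) hn

/-- **Print-faithfulness at `2` on the nose**: the image of `C₁ = V.endEigenPrimaryTorsion 2 π r`
in `E(K̄)` is `{P | ∃ n, πⁿ P = 0} = ⋃ₙ E[𝔭ⁿ] = E[𝔭^∞]`, `𝔭 = (π)`.
[cite: Rubin1999, §5 (p. 179) and §5.1 (p. 180: E[𝔞^∞] = ∪ₙ E[𝔞ⁿ])] -/
theorem mem_map_subtype_endEigenPrimaryTorsion_two_iff (π : V.endRing)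
    (hπ : (π : AddMonoid.End V.geomPoints) * π = π - 2) {r : ℤ_[2]} (hr : r * r = r - 2)
    (hr1 : ‖r‖ < 1) (y : V.geomPoints) :
    y ∈ (V.endEigenPrimaryTorsion 2 π r).map (V.geomPrimaryTorsion 2).subtype ↔
      ∃ n : ℕ, ((π : AddMonoid.End V.geomPoints) ^ n) y = 0 :=
  mem_map_subtype_endEigenPrimaryTorsion_iff π (t := 1)
    (fun z ↦ by simpa using quadratic_two_pointwise π hπ z)
    (by rw [hr]; push_cast; ring) hr1 (by decide) y

end Two

end WeierstrassCurve

end
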